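import Summits.Ventures.DiscreteObjects.Hadamard.RegularHadamard668

/-!
# No H(668) and no C(334) invariant under a regular group action — 'group-developed' types are EMPTY (kernel)

Framing: lottery ticket; floor = certified bounds/negative ranges.  Cell pub-namedobj (venture DiscreteObjects),
target (H), hadamard gen 28; a short '(types)' complement to `RegularHadamard668` (gen 27: no regular / graphical
`H(668)`) and to the `GroupCore334` chapter (no regular group on the CORE of `C(334)`).  Here the group acts
regularly on ALL rows = columns:
* **`no_groupDeveloped_hadamard668`** / **`no_leftInvariant_hadamard668`** — no Hadamard matrix of order `668` is a
  group matrix `H_{g,h} = a(g⁻¹h)` over a group of order `668`, equivalently none is invariant under the left-regular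
  action `H_{xg,xh} = H_{g,h}` (unsigned!): a group matrix has constant row sums, and a regular `H(n)` needs `n = s²`
  (`regular_hadamard_rowsum_sq`, gen 27) — Menon; classical.  (The SIGNED analogue — cocyclic `H(668)`, e.g. of Ito
  type — is NOT excluded: for even `|G|` the signs are not a coboundary; cf. gens 21–23.)
* **`regular_conference_rowsum_sq`** — a conference-type matrix (`C Cᵀ = (n−1)·I`, `n ≥ 2`) with constant row sums
  `s` has `s² = n − 1` (any order; via `Cᵀ C = (n−1)·I` and `Σ_i (Σ_j C_{ij})² = (n−1)·n`);
  **`no_regular_conference334`**, **`no_leftInvariant_conference334`** — `333` is not a square, so no `C(334)` has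
  constant row sums, in particular none is a group matrix over / invariant under a regular action of a group of
  order `334` (`ℤ/334` or the dihedral group `D₁₆₇`).  Classical in substance; kernel statements for the census
  '(types)' rows.  `H(668)`, `C(334)` themselves untouched.  No `sorry`, no new definitions.
-/

namespace Summit.Ventures.DiscreteObjects.Hadamard

open Finset
open scoped Matrix

open Literature.Combinatorics.Designs.GoethalsSeidel (IsHadamardMatrix)

section hadamard
variable {G : Type*} [Group G] [Fintype G] [DecidableEq G]

/-- **No group-developed `H(668)`**: a group matrix `H_{g,h} = a(g⁻¹h)` over a group of order `668` is never
Hadamard (its row sums all equal `Σ a`, and `668` is not a square). -/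
theorem no_groupDeveloped_hadamard668 (hG : Fintype.card G = 668) (a : G → ℤ) (H : Matrix G G ℤ)
    (hH : ∀ g h, H g h = a (g⁻¹ * h)) (hHad : IsHadamardMatrix H) : False := by
  refine no_regular_hadamard668 hG hHad (s := ∑ u, a u) fun g => ?_
  simp only [hH]
  exact Fintype.sum_equiv (Equiv.mulLeft g⁻¹) _ _ fun h => rfl

/-- **No `H(668)` invariant under a regular (unsigned) group action on its rows = columns**: if
`H_{xg,xh} = H_{g,h}` for all `x` in a group `G` of order `668` indexing `H`, then `H` is not Hadamard. -/
theorem no_leftInvariant_hadamard668 (hG : Fintype.card G = 668) (H : Matrix G G ℤ) (hHad : IsHadamardMatrix H)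
    (hinv : ∀ x g h, H (x * g) (x * h) = H g h) : False :=
  no_groupDeveloped_hadamard668 hG (fun u => H 1 u) H
    (fun g h => by simpa using (hinv g⁻¹ g h).symm) hHad

end hadamard

section conference
variable {ι : Type*} [Fintype ι] [DecidableEq ι]

/-- **Regular conference-type matrices have square `n − 1`.**  If `C Cᵀ = (n−1)·I` over `ℤ` (`n = |ι| ≥ 2`) and all
row sums of `C` equal `s`, then `s² = n − 1`. -/
theorem regular_conference_rowsum_sq (hn : 2 ≤ Fintype.card ι) (C : Matrix ι ι ℤ)
    (hC : C * Cᵀ = ((Fintype.card ι : ℤ) - 1) • (1 : Matrix ι ι ℤ)) {s : ℤ} (hs : ∀ i, ∑ j, C i j = s) :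
    s ^ 2 = Fintype.card ι - 1 := by
  have hk : ((Fintype.card ι : ℤ) - 1) ≠ 0 := by
    have : (2 : ℤ) ≤ Fintype.card ι := by exact_mod_cast hn
    linarith
  have hT := transpose_mul_self_of_mul_transpose C _ hk hC
  have h := sum_rowsum_sq C hT
  simp only [hs, Finset.sum_const, Finset.card_univ, nsmul_eq_mul] at h
  have hpos : (0 : ℤ) < Fintype.card ι := by exact_mod_cast (by omega : 0 < Fintype.card ι)
  have h' : (Fintype.card ι : ℤ) * (s ^ 2 - (Fintype.card ι - 1)) = 0 := by
    rw [mul_sub]; linarith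
  rcases mul_eq_zero.mp h' with h1 | h1
  · linarith
  · linarith

/-- **No regular `C(334)`**: a matrix of order `334` with `C Cᵀ = 333·I` cannot have constant row sums
(`333` is not a square). -/
theorem no_regular_conference334 (hι : Fintype.card ι = 334) (C : Matrix ι ι ℤ)
    (hC : C * Cᵀ = (333 : ℤ) • (1 : Matrix ι ι ℤ)) {s : ℤ} (hs : ∀ i, ∑ j, C i j = s) : False := by
  have h := regular_conference_rowsum_sq (by rw [hι]; norm_num) C (by rw [hι]; exact_mod_cast hC) hs
  rw [hι] at h
  norm_num at h
  have hb : -19 < s ∧ s < 19 := by constructor <;> nlinarith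
  obtain ⟨h1, h2⟩ := hb
  interval_cases s <;> omega

end conference

section conferenceGroup
variable {G : Type*} [Group G] [Fintype G] [DecidableEq G]

/-- **No `C(334)` invariant under a regular group action** (in particular no group-developed conference matrix of
order `334` over `ℤ/334` or `D₁₆₇`): invariance `C_{xg,xh} = C_{g,h}` makes all row sums equal to `Σ_u C_{1,u}`. -/
theorem no_leftInvariant_conference334 (hG : Fintype.card G = 334) (C : Matrix G G ℤ)
    (hC : C * Cᵀ = (333 : ℤ) • (1 : Matrix G G ℤ)) (hinv : ∀ x g h, C (x * g) (x * h) = C g h) : False := by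
  refine no_regular_conference334 hG C hC (s := ∑ u, C 1 u) fun g => ?_
  have hrow : ∀ h, C g h = C 1 (g⁻¹ * h) := fun h => by simpa using (hinv g⁻¹ g h).symm
  simp only [hrow]
  exact Fintype.sum_equiv (Equiv.mulLeft g⁻¹) _ _ fun h => rfl

end conferenceGroup

end Summit.Ventures.DiscreteObjects.Hadamard
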